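import Literature.NumberTheory.LFunctions.ZetaZeroDetection
import Literature.NumberTheory.LFunctions.ZeroDensityIngham
import Literature.NumberTheory.LFunctions.HalaszTuranDensityProofs
import Literature.NumberTheory.LFunctions.FordZetaBoundCrude
import HarnessLib

/-!
# Zero detection and the Halász–Montgomery kernel on a general line `Re s = α`

NOT RH-BEARING (D-0040; bears_on LADDER-RH §4 HELD row `DensityLadder`, stmt-19600): a density
theorem counts zeros off the line, it never empties the strip (Barrier `LindelofBacklund`);
corpus theorems are RH-FREE literature and nothing in this file is worded as progress toward RH.

Topic `NumberTheory/LFunctions`, family RH, statement **rh.S12**; corpus C4 (Guth–Maynard §13.2),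
work package WP-D2a: the two analytic inputs of Montgomery's zero-detection method that the
near-`σ = 1` density theorem (`Literature.NumberTheory.LFunctions.NearOneZeroDensity`, Ivić 1985
Thm. 11.3 / Montgomery 1971 Thm. 12.3) needs ON A GENERAL LINE `Re s = α`, `1/2 ≤ α < 1` — the
tree's versions (`ZeroDetect.zeroDetection_norm_ineq`, `ZeroDensity.perZero_dichotomy`,
`HalaszTuranLH.smoothedKernel_identity`, `HalaszTuranLH.norm_smoothedKernel_le`) are written on the
critical line `α = 1/2`. Ivić, *The Riemann Zeta-Function* (1985), §11.2 and §11.4, moves both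
lines of integration to `Re = α` with `α = 5σ − 4` close to `1`, where the order of `ζ` is small
(Richert: `ζ(α + it) ≪ t^{D(1−α)^{3/2}} log^{2/3} t`): (11.44)–(11.48) (class-`R₁` zeros via the
Halász–Montgomery inequality with `M(α, 3T) = max_{t ≤ 3T} |ζ(α+it)|`) and (11.45) (class-`R₂`
zeros via the zero-detecting integral on `Re = α`).

## Contents (all PROVED; no definition of a notion, no named fact)

* `NearOneDetect.zeroDetection_main_line`, `…_norm_ineq_line` — Ivić (11.5)–(11.10) with the
  Riesz kernel `K(w) = 2/(w(w+1)(w+2))` (as in `ZetaZeroDetection.lean`) and the line of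
  integration `Re w = α − β` (`1/2 ≤ α < β = Re ρ`): for a zero `ρ = β + iγ`, `X, Y ≥ 1`,
  `(1 − 1/Y)² ≤ |∑_{X<n≤Y} a_X(n)(1−n/Y)² n^{−ρ}| + Y^{1−β}|K(1−ρ)|(1 + log X)`
  `+ (Y^{α−β}/2π) ∫ |K(α−β+iy)| |ζ(α+i(γ+y))| |M_X(α+i(γ+y))| dy`.
* `NearOneDetect.norm_mollifier_le_rpow` — `|M_X(s)| ≤ 1 + X^{1−σ}/(1−σ)` for `0 ≤ σ = Re s < 1`
  (the bound that makes the line `α` useful; the tree's `ZeroDetect.norm_mollifier_le` gives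
  only `≤ X`).
* `NearOneDetect.perZero_dichotomy_line`, `NearOneDetect.classOne_of_sup_line` — the Class I /
  Class II dichotomy at level `α` over `1`-spaced dyadic heights `U < γ ≤ 2U`, and "every zero
  is of Class I" once `Y^{σ−α}` beats `sup_{|t|≤3U}|ζ(α+it)| · X^{1−α}/((1−α)(σ−α)²)`.
* `NearOneDetect.smoothedKernel_identity_line`, `NearOneDetect.norm_smoothedKernel_le_line` —
  the smoothed Halász–Montgomery kernel `G_Y(τ) = ∑_{n≤Y}(1−n/Y)² n^{−iτ}` with Perron's line
  moved to `Re w = α`: `|G_Y(τ)| ≤ 2Y/|τ|³ + Y^α (c₁ S + c₂)` for `1 ≤ |τ| ≤ U` when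
  `|ζ(α+it)| ≤ S` on `|t| ≤ 3U` — the `hker` input of `HalaszTuranLH.halasz_block_count`
  (Ivić (11.46)–(11.47), the term `M^{1+α−2σ} M(α,3T)`).
* `NearOneDetect.exists_norm_zeta_line_le` — the crude bound `|ζ(α+it)| ≤ 1/(1−α) + K(1+|t|)`
  on `1/2 ≤ α < 1` used for the tails.

## References

* A. Ivić, *The Riemann Zeta-Function* (1985), §11.2 (11.4)–(11.12) (pp. 269–272, held chunks
  p0207–p0208) and §11.4, proof of Theorem 11.3, (11.44)–(11.52) (pp. 279–281, chunks
  p0214–p0216). [key `Ivic1985`]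
* H. L. Montgomery, *Topics in Multiplicative Number Theory*, LNM 227 (1971), Theorems 8.2, 12.3.
  [key `Montgomery1971`]
* E. C. Titchmarsh, *The Theory of the Riemann Zeta-Function*, 2nd ed. (1986), §9.16 (mollifier),
  §9.28 (Halász's lemma). [key `Titchmarsh1986`]
-/

noncomputable section

open Complex Filter Topology Set MeasureTheory Finset
open scoped Real

namespace Literature.NumberTheory.LFunctions

namespace NearOneDetect

open ZeroDetect

/-! ## Part A1. Zero detection on the line `Re w = α − β` -/

section Shift

variable {X Y : ℕ} {ρ : ℂ} {α : ℝ}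

/-- `ρ + (α − β + iy) = α + i(γ + y)` for `ρ = β + iγ`. [folklore] -/
private theorem rho_add_line_alpha (ρ : ℂ) (α y : ℝ) :
    ρ + (((α - ρ.re : ℝ) : ℂ) + y * I) = (α : ℂ) + (ρ.im + y) * I := by
  apply Complex.ext <;> simp

/-- **The zero-detecting identity on the line `Re w = α − β`** (Ivić (11.5)–(11.7), Riesz-kernel
variant of `ZeroDetect.zeroDetection_main`, the line `1/2 − β` replaced by `α − β` with
`1/2 ≤ α < β`): for a zero `ρ = β + iγ` of `ζ` with `β < 1` and integers `X, Y ≥ 1`, the line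
integrand `y ↦ Y^{α−β+iy} K(α−β+iy) ζ(α+i(γ+y)) M_X(α+i(γ+y))` is integrable and
`∑_{n≤Y} a_X(n)(1−n/Y)² n^{−ρ} = Y^{1−ρ}K(1−ρ)M_X(1) + (1/2π)∫ Y^{α−β+iy}K(α−β+iy)ζ(α+i(γ+y))M_X(α+i(γ+y)) dy`
(Perron on `Re w = 2` moved to `Re w = α − β ∈ [1/2 − β, 0)`: the pole of `K` at `0` is killed by
`ζ(ρ) = 0`, the pole of `ζ(ρ+w)` at `w = 1 − ρ` gives the first term).
[cite: Ivic1985, §11.2 (11.4)–(11.7) and §11.4 (11.45)] -/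
theorem zeroDetection_main_line (hX : 1 ≤ X) (hY : 1 ≤ Y) (hα : 1 / 2 ≤ α) (hαβ : α < ρ.re)
    (hβ1 : ρ.re < 1) (hζ : riemannZeta ρ = 0) :
    Integrable (fun y : ℝ ↦
        (Y : ℂ) ^ (((α - ρ.re : ℝ) : ℂ) + y * I) * rieszK (((α - ρ.re : ℝ) : ℂ) + y * I) *
          (riemannZeta (α + (ρ.im + y) * I) * mollifier X (α + (ρ.im + y) * I))) ∧
    ∑ n ∈ Finset.range Y, mollCoeff X (n + 1) *
        ((((1 : ℝ) - ((n : ℝ) + 1) / Y) ^ 2 : ℝ) : ℂ) * ((n : ℂ) + 1) ^ (-ρ) =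
      (Y : ℂ) ^ (1 - ρ) * rieszK (1 - ρ) * mollifier X 1 +
      ((1 / (2 * π) : ℝ) : ℂ) * ∫ y : ℝ,
        (Y : ℂ) ^ (((α - ρ.re : ℝ) : ℂ) + y * I) * rieszK (((α - ρ.re : ℝ) : ℂ) + y * I) *
          (riemannZeta (α + (ρ.im + y) * I) * mollifier X (α + (ρ.im + y) * I)) := by
  have hY0 : 0 < Y := hY
  have hβ : 1 / 2 < ρ.re := lt_of_le_of_lt hα hαβ
  have hρ1 : ρ ≠ 1 := fun h ↦ by rw [h] at hβ1; simp at hβ1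
  set a : ℝ := α - ρ.re with ha_def
  have ha : -1 < a := by rw [ha_def]; linarith
  have ha0 : a < 0 := by rw [ha_def]; linarith
  have ha2 : a ≤ 2 := by linarith
  have haστ : 1 / 2 - ρ.re ≤ a := by rw [ha_def]; linarith
  set z₁ : ℂ := 1 - ρ with hz₁_def
  have hz₁re : z₁.re = 1 - ρ.re := by simp [hz₁_def]
  have hz₁0 : z₁ ≠ 0 := sub_ne_zero.2 (Ne.symm hρ1)
  have hz₁1 : (1 : ℂ) + z₁ ≠ 0 := fun h ↦ by
    have := congrArg Complex.re h; rw [add_re, hz₁re] at this; simp at this; linarith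
  have hz₁2 : (2 : ℂ) + z₁ ≠ 0 := fun h ↦ by
    have := congrArg Complex.re h; rw [add_re, hz₁re] at this; simp at this; linarith
  set A : ℂ := shiftAux₁ X Y ρ z₁ / z₁ with hA_def
  -- Step 1: Perron on `Re z = 2`
  have hPerron := rieszSum_eq_integral (c := 2) (by norm_num) (s := ρ) (by linarith) X hY0
  rw [hPerron]
  have hG2 : ∀ y : ℝ, (Y : ℂ) ^ (((2 : ℝ) : ℂ) + y * I) * rieszK (((2 : ℝ) : ℂ) + y * I) *
      (riemannZeta (ρ + (2 : ℝ) + y * I) * mollifier X (ρ + (2 : ℝ) + y * I)) =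
      perronIntegrand X Y ρ (((2 : ℝ) : ℂ) + y * I) := by
    intro y; simp only [perronIntegrand, add_assoc]
  simp_rw [hG2]
  -- Step 2: the three pieces on the two lines (the strip bounds of the tree restrict to `[a, 2]`)
  obtain ⟨C₀, hC₀0, hC₀'⟩ := norm_shiftPiece₀_le (X := X) (Y := Y) (ρ := ρ) hX hY hβ hβ1
  obtain ⟨C₁, hC₁0, hC₁'⟩ := norm_shiftPiece₁_le (X := X) (Y := Y) (ρ := ρ) hX hY hβ hβ1
  have hC₀ : ∀ σ ∈ Set.Icc a 2, ∀ T : ℝ, |ρ.im| + 2 ≤ |T| →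
      ‖shiftPiece₀ X Y ρ (σ + T * I)‖ ≤ C₀ / T ^ 2 :=
    fun σ hσ T hT ↦ hC₀' σ ⟨haστ.trans hσ.1, hσ.2⟩ T hT
  have hC₁ : ∀ σ ∈ Set.Icc a 2, ∀ T : ℝ, 2 * |ρ.im| + 2 ≤ |T| →
      ‖shiftPiece₁ X Y ρ (σ + T * I)‖ ≤ C₁ / T ^ 2 :=
    fun σ hσ T hT ↦ hC₁' σ ⟨haστ.trans hσ.1, hσ.2⟩ T hT
  have hR0 : 1 ≤ |ρ.im| + 2 := by linarith [abs_nonneg ρ.im]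
  have hR1 : 1 ≤ 2 * |ρ.im| + 2 := by linarith [abs_nonneg ρ.im]
  obtain ⟨hI0a, hI0b, hS0⟩ := integral_line_eq_of_sq_bound (differentiableOn_shiftPiece₀ X hY0 ρ) ha ha2
    hC₀0 hR0 hC₀
  obtain ⟨hI1a, hI1b, hS1⟩ := integral_line_eq_of_sq_bound
    (differentiableOn_shiftPiece₁ X hY0 (ρ := ρ) (by linarith)) ha ha2 hC₁0 hR1 hC₁
  have hz₁a : a ≠ z₁.re := by rw [hz₁re]; linarith
  have hz₁b : (2 : ℝ) ≠ z₁.re := by rw [hz₁re]; linarith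
  have hz₁m : -1 < z₁.re := by rw [hz₁re]; linarith
  have hIKa := integrable_rieszKt_div_sub_line (z₁ := z₁) ha hz₁a hz₁m
  have hIKb := integrable_rieszKt_div_sub_line (z₁ := z₁) (c := 2) (by norm_num) hz₁b hz₁m
  have hVKa := integral_rieszKt_div_sub_line (z₁ := z₁) ha hz₁a hz₁m
  have hVKb := integral_rieszKt_div_sub_line (z₁ := z₁) (c := 2) (by norm_num) hz₁b hz₁m
  rw [if_neg (by rw [hz₁re]; linarith)] at hVKa
  rw [if_pos (by rw [hz₁re]; linarith)] at hVKb
  -- pointwise decompositions on the two lines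
  have hdec : ∀ (c : ℝ), c ≠ 0 → -1 < c → c ≠ z₁.re → ∀ y : ℝ,
      perronIntegrand X Y ρ ((c : ℂ) + y * I) = shiftPiece₀ X Y ρ ((c : ℂ) + y * I) +
        shiftPiece₁ X Y ρ ((c : ℂ) + y * I) +
        A * (rieszKt ((c : ℂ) + y * I) / (((c : ℂ) + y * I) - z₁)) := by
    intro c hc0 hc1 hcz y
    have h0 : (c : ℂ) + y * I ≠ 0 := ofReal_add_mul_I_ne (w := 0) (by simpa using hc0) y
    have h1 : (c : ℂ) + y * I + 1 ≠ 0 := by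
      have := ofReal_add_mul_I_ne (c := c) (w := -1) (by simp; linarith) y
      intro h; apply this; linear_combination h
    have h2 : (c : ℂ) + y * I + 2 ≠ 0 := by
      have := ofReal_add_mul_I_ne (c := c) (w := -2) (by simp; linarith) y
      intro h; apply this; linear_combination h
    have hzz : (c : ℂ) + y * I ≠ 1 - ρ := ofReal_add_mul_I_ne (by rwa [← hz₁_def]) y
    exact perronIntegrand_eq_decomp hζ hρ1 h0 h1 h2 hzz
  -- Step 3: integral on `Re z = 2`
  have hInt2 : ∫ y : ℝ, perronIntegrand X Y ρ (((2 : ℝ) : ℂ) + y * I) =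
      (∫ y : ℝ, shiftPiece₀ X Y ρ (((2 : ℝ) : ℂ) + y * I)) +
        ∫ y : ℝ, shiftPiece₁ X Y ρ (((2 : ℝ) : ℂ) + y * I) := by
    have e : (fun y : ℝ ↦ perronIntegrand X Y ρ (((2 : ℝ) : ℂ) + y * I)) = fun y : ℝ ↦
        (shiftPiece₀ X Y ρ (((2 : ℝ) : ℂ) + y * I) + shiftPiece₁ X Y ρ (((2 : ℝ) : ℂ) + y * I)) +
        A * (rieszKt (((2 : ℝ) : ℂ) + y * I) / ((((2 : ℝ) : ℂ) + y * I) - z₁)) := by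
      funext y; exact hdec 2 (by norm_num) (by norm_num) hz₁b y
    have hI01b : Integrable fun y : ℝ ↦
        shiftPiece₀ X Y ρ (((2 : ℝ) : ℂ) + y * I) + shiftPiece₁ X Y ρ (((2 : ℝ) : ℂ) + y * I) :=
      hI0b.add hI1b
    rw [e, integral_add hI01b (hIKb.const_mul A), integral_add hI0b hI1b,
      integral_const_mul]
    have : (∫ y : ℝ, rieszKt (((2 : ℝ) : ℂ) + y * I) / ((((2 : ℝ) : ℂ) + y * I) - z₁)) = 0 := by
      exact_mod_cast hVKb
    rw [this, mul_zero, add_zero]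
  -- Step 4: integrability and the integral on `Re z = a`
  have hIG : Integrable fun y : ℝ ↦ perronIntegrand X Y ρ ((a : ℂ) + y * I) := by
    have e' : (fun y : ℝ ↦ perronIntegrand X Y ρ ((a : ℂ) + y * I)) = fun y : ℝ ↦
        (shiftPiece₀ X Y ρ ((a : ℂ) + y * I) + shiftPiece₁ X Y ρ ((a : ℂ) + y * I)) +
        A * (rieszKt ((a : ℂ) + y * I) / (((a : ℂ) + y * I) - z₁)) := by
      funext y; exact hdec a ha0.ne ha hz₁a y
    rw [e']
    exact (hI0a.add hI1a).add (hIKa.const_mul A)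
  have hInta : (∫ y : ℝ, shiftPiece₀ X Y ρ ((a : ℂ) + y * I)) +
      (∫ y : ℝ, shiftPiece₁ X Y ρ ((a : ℂ) + y * I)) =
      (∫ y : ℝ, perronIntegrand X Y ρ ((a : ℂ) + y * I)) + A * ((2 * π) * rieszKt z₁) := by
    have e : (fun y : ℝ ↦ shiftPiece₀ X Y ρ ((a : ℂ) + y * I) + shiftPiece₁ X Y ρ ((a : ℂ) + y * I)) =
        fun y : ℝ ↦ perronIntegrand X Y ρ ((a : ℂ) + y * I) +
          (-A) * (rieszKt ((a : ℂ) + y * I) / (((a : ℂ) + y * I) - z₁)) := by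
      funext y; rw [hdec a ha0.ne ha hz₁a y]; ring
    rw [← integral_add hI0a hI1a, e, integral_add hIG (hIKa.const_mul _), integral_const_mul, hVKa]
    ring
  -- Step 5: the residue term
  have hres : A * ((2 * π) * rieszKt z₁) =
      (2 * π) * ((Y : ℂ) ^ (1 - ρ) * rieszK (1 - ρ) * mollifier X 1) := by
    have hK : rieszK z₁ = rieszKt z₁ / z₁ := by
      have h1' : z₁ + 1 ≠ 0 := by rw [add_comm]; exact hz₁1
      have h2' : z₁ + 2 ≠ 0 := by rw [add_comm]; exact hz₁2
      rw [rieszK, rieszKt, Literature.NumberTheory.LFunctions.RieszPerron.Kfun_eq hz₁0 h1' h2']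
      field_simp
    rw [hA_def, shiftAux₁, hK, show ρ + z₁ = 1 by rw [hz₁_def]; ring, hz₁_def]
    field_simp
  -- Step 6: assemble
  have hGa : ∀ y : ℝ, perronIntegrand X Y ρ ((a : ℂ) + y * I) =
      (Y : ℂ) ^ (((α - ρ.re : ℝ) : ℂ) + y * I) * rieszK (((α - ρ.re : ℝ) : ℂ) + y * I) *
        (riemannZeta (α + (ρ.im + y) * I) * mollifier X (α + (ρ.im + y) * I)) := by
    intro y
    simp only [perronIntegrand, ha_def, rho_add_line_alpha]
  refine ⟨by simp_rw [hGa] at hIG; exact hIG, ?_⟩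
  rw [hInt2, ← hS0, ← hS1, hInta, hres]
  simp_rw [hGa]
  generalize (∫ y : ℝ, (Y : ℂ) ^ (((α - ρ.re : ℝ) : ℂ) + y * I) *
    rieszK (((α - ρ.re : ℝ) : ℂ) + y * I) *
      (riemannZeta (α + (ρ.im + y) * I) * mollifier X (α + (ρ.im + y) * I))) = J
  have hπ : (π : ℂ) ≠ 0 := by exact_mod_cast Real.pi_ne_zero
  push_cast
  field_simp
  ring

/-- **The zero-detecting inequality at level `α`** (Class I / Class II dichotomy, Ivić
(11.8)–(11.10) with the line `Re = α` of (11.45)). For a zero `ρ = β + iγ` of `ζ`,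
`1/2 ≤ α < β < 1`, and integers `X, Y ≥ 1`:
`(1 − 1/Y)² ≤ |∑_{X<n≤Y} a_X(n)(1−n/Y)² n^{−ρ}| + Y^{1−β}|K(1−ρ)|(1 + log X)`
`+ (Y^{α−β}/2π) ∫_ℝ |K(α−β+iy)| |ζ(α+i(γ+y))| |M_X(α+i(γ+y))| dy`.
[cite: Ivic1985, §11.2 (11.8)–(11.10) and §11.4 (11.45)] -/
theorem zeroDetection_norm_ineq_line (hX : 1 ≤ X) (hY : 1 ≤ Y) (hα : 1 / 2 ≤ α) (hαβ : α < ρ.re)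
    (hβ1 : ρ.re < 1) (hζ : riemannZeta ρ = 0) :
    ((1 : ℝ) - 1 / Y) ^ 2 ≤
      ‖∑ n ∈ Finset.Ioc X Y, mollCoeff X n *
          ((((1 : ℝ) - (n : ℝ) / Y) ^ 2 : ℝ) : ℂ) * (n : ℂ) ^ (-ρ)‖ +
      (Y : ℝ) ^ (1 - ρ.re) * ‖rieszK (1 - ρ)‖ * (1 + Real.log X) +
      1 / (2 * π) * (Y : ℝ) ^ (α - ρ.re) *
        ∫ y : ℝ, ‖rieszK (((α - ρ.re : ℝ) : ℂ) + y * I)‖ *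
          (‖riemannZeta (α + (ρ.im + y) * I)‖ * ‖mollifier X (α + (ρ.im + y) * I)‖) := by
  have hY0 : (0 : ℝ) < Y := by exact_mod_cast hY
  have hid := (zeroDetection_main_line hX hY hα hαβ hβ1 hζ).2
  rw [rieszSum_eq_sum_Icc, sum_Icc_eq_first_add_sum_Ioc hX hY] at hid
  set S := ∑ n ∈ Finset.Ioc X Y, mollCoeff X n *
    ((((1 : ℝ) - (n : ℝ) / Y) ^ 2 : ℝ) : ℂ) * (n : ℂ) ^ (-ρ) with hS
  set R := (Y : ℂ) ^ (1 - ρ) * rieszK (1 - ρ) * mollifier X 1 with hR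
  set F : ℝ → ℂ := fun y ↦ (Y : ℂ) ^ (((α - ρ.re : ℝ) : ℂ) + y * I) *
    rieszK (((α - ρ.re : ℝ) : ℂ) + y * I) *
      (riemannZeta (α + (ρ.im + y) * I) * mollifier X (α + (ρ.im + y) * I)) with hF
  have hJ : (∫ y : ℝ, (Y : ℂ) ^ (((α - ρ.re : ℝ) : ℂ) + y * I) *
    rieszK (((α - ρ.re : ℝ) : ℂ) + y * I) *
      (riemannZeta (α + (ρ.im + y) * I) * mollifier X (α + (ρ.im + y) * I))) = ∫ y, F y := rfl
  rw [hJ] at hid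
  have heq : ((((1 : ℝ) - 1 / Y) ^ 2 : ℝ) : ℂ) = -S + R + ((1 / (2 * π) : ℝ) : ℂ) * ∫ y, F y := by
    linear_combination hid
  have hnS : ‖-S‖ = ‖S‖ := norm_neg _
  have hnR : ‖R‖ ≤ (Y : ℝ) ^ (1 - ρ.re) * ‖rieszK (1 - ρ)‖ * (1 + Real.log X) := by
    rw [hR, norm_mul, norm_mul, Complex.norm_natCast_cpow_of_pos hY, sub_re, one_re]
    exact mul_le_mul_of_nonneg_left (norm_mollifier_one_le X) (by positivity)
  have hnF : ∀ y : ℝ, ‖F y‖ = (Y : ℝ) ^ (α - ρ.re) *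
      (‖rieszK (((α - ρ.re : ℝ) : ℂ) + y * I)‖ *
        (‖riemannZeta (α + (ρ.im + y) * I)‖ * ‖mollifier X (α + (ρ.im + y) * I)‖)) := by
    intro y
    simp only [hF, norm_mul, Complex.norm_natCast_cpow_of_pos hY, add_re, ofReal_re, mul_re,
      I_re, I_im, ofReal_im]
    ring_nf
  have hnI : ‖((1 / (2 * π) : ℝ) : ℂ) * ∫ y, F y‖ ≤ 1 / (2 * π) * (Y : ℝ) ^ (α - ρ.re) *
      ∫ y : ℝ, ‖rieszK (((α - ρ.re : ℝ) : ℂ) + y * I)‖ *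
        (‖riemannZeta (α + (ρ.im + y) * I)‖ * ‖mollifier X (α + (ρ.im + y) * I)‖) := by
    rw [norm_mul, Complex.norm_real, Real.norm_of_nonneg (by positivity), mul_assoc]
    refine mul_le_mul_of_nonneg_left ?_ (by positivity)
    calc ‖∫ y, F y‖ ≤ ∫ y, ‖F y‖ := norm_integral_le_integral_norm _
      _ = ∫ y : ℝ, (Y : ℝ) ^ (α - ρ.re) *
          (‖rieszK (((α - ρ.re : ℝ) : ℂ) + y * I)‖ *
            (‖riemannZeta (α + (ρ.im + y) * I)‖ * ‖mollifier X (α + (ρ.im + y) * I)‖)) :=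
          integral_congr_ae (Eventually.of_forall hnF)
      _ = (Y : ℝ) ^ (α - ρ.re) * ∫ y : ℝ, ‖rieszK (((α - ρ.re : ℝ) : ℂ) + y * I)‖ *
            (‖riemannZeta (α + (ρ.im + y) * I)‖ * ‖mollifier X (α + (ρ.im + y) * I)‖) :=
          integral_const_mul _ _
  have hlhs : ((1 : ℝ) - 1 / Y) ^ 2 = ‖((((1 : ℝ) - 1 / Y) ^ 2 : ℝ) : ℂ)‖ := by
    rw [Complex.norm_real, Real.norm_of_nonneg (sq_nonneg _)]
  rw [hlhs, heq]
  calc ‖-S + R + ((1 / (2 * π) : ℝ) : ℂ) * ∫ y, F y‖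
      ≤ ‖-S‖ + ‖R‖ + ‖((1 / (2 * π) : ℝ) : ℂ) * ∫ y, F y‖ := norm_add₃_le
    _ ≤ _ := by rw [hnS]; linarith

end Shift

/-! ## Part A2. Bounds on the line `Re s = α`: the mollifier, `ζ`, and the Class-II integral -/

section LineBounds

/-- **The mollifier on the line `Re s = σ ∈ [0, 1)`**: `|M_X(s)| ≤ ∑_{d ≤ X} d^{−σ} ≤ 1 + X^{1−σ}/(1−σ)`
(`|μ(d)| ≤ 1` and the integral comparison `FordVK.sum_rpow_neg_le_div`). For `σ` close to `1`
this is `≪ X^{1−σ}/(1−σ)`, much better than the trivial `≤ X` of `ZeroDetect.norm_mollifier_le`;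
it is what makes the line `Re = α = 5σ − 4` of Ivić (11.45) effective. [cite: Ivic1985, §11.4 (11.45)] -/
theorem norm_mollifier_le_rpow {X : ℕ} (hX : 1 ≤ X) {s : ℂ} (h0 : 0 ≤ s.re) (h1 : s.re < 1) :
    ‖mollifier X s‖ ≤ 1 + (X : ℝ) ^ (1 - s.re) / (1 - s.re) := by
  unfold mollifier
  calc ‖∑ d ∈ Finset.Icc 1 X, ((ArithmeticFunction.moebius d : ℤ) : ℂ) * (d : ℂ) ^ (-s)‖
      ≤ ∑ d ∈ Finset.Icc 1 X, ‖((ArithmeticFunction.moebius d : ℤ) : ℂ) * (d : ℂ) ^ (-s)‖ :=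
        norm_sum_le _ _
    _ ≤ ∑ d ∈ Finset.Icc 1 X, (d : ℝ) ^ (-s.re) := Finset.sum_le_sum fun d hd ↦ by
        simp only [Finset.mem_Icc] at hd
        have hd0 : (0 : ℝ) < d := by exact_mod_cast hd.1
        rw [norm_mul, show ((d : ℂ)) = ((d : ℝ) : ℂ) by norm_cast,
          Complex.norm_cpow_eq_rpow_re_of_pos hd0, neg_re]
        have h1 : ‖((ArithmeticFunction.moebius d : ℤ) : ℂ)‖ ≤ 1 := by
          rw [Complex.norm_intCast]; exact_mod_cast ArithmeticFunction.abs_moebius_le_one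
        calc ‖((ArithmeticFunction.moebius d : ℤ) : ℂ)‖ * (d : ℝ) ^ (-s.re)
            ≤ 1 * (d : ℝ) ^ (-s.re) :=
              mul_le_mul_of_nonneg_right h1 (Real.rpow_nonneg hd0.le _)
          _ = (d : ℝ) ^ (-s.re) := one_mul _
    _ ≤ 1 + (X : ℝ) ^ (1 - s.re) / (1 - s.re) := FordVK.sum_rpow_neg_le_div h0 h1 hX

/-- **A crude bound for `ζ` on the lines `1/2 ≤ Re s < 1`**: there is `K ≥ 1` with
`|ζ(α + it)| ≤ 1/(1 − α) + K(1 + |t|)` for all `1/2 ≤ α < 1` and all real `t`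
(`ζ(s) = 1/(s−1) + ζ₀(s)` with `ζ₀` entire: `|ζ₀(s)| ≤ 3|s| + 1` for `|Im s| ≥ 1`,
`ZeroDetect.norm_riemannZeta₀_le`, Titchmarsh (2.12.2); bounded on the compact piece
`|Im s| ≤ 1` by continuity; `|1/(s−1)| ≤ 1/(1−α)`). [cite: Titchmarsh1986, §2.12 eq. (2.12.2)] -/
theorem exists_norm_zeta_line_le :
    ∃ K : ℝ, 1 ≤ K ∧ ∀ α t : ℝ, 1 / 2 ≤ α → α < 1 →
      ‖riemannZeta ((α : ℂ) + t * I)‖ ≤ 1 / (1 - α) + K * (1 + |t|) := by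
  -- `ζ₀` on the compact rectangle `[1/2, 1] × [-1, 1]`
  have hc : IsCompact (Set.Icc (1 / 2 : ℝ) 1 ×ℂ Set.Icc (-1 : ℝ) 1) :=
    isCompact_Icc.reProdIm isCompact_Icc
  obtain ⟨K₀, hK₀⟩ := hc.exists_bound_of_continuousOn
    (differentiable_riemannZeta₀.continuous.continuousOn)
  refine ⟨max K₀ 4, le_trans (by norm_num) (le_max_right _ _), fun α t hα hα1 ↦ ?_⟩
  set s : ℂ := (α : ℂ) + t * I with hs
  have hsre : s.re = α := by simp [hs]
  have hsim : s.im = t := by simp [hs]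
  have hs1 : s ≠ 1 := fun h ↦ by
    have := congrArg Complex.re h; rw [hsre] at this; simp at this; linarith
  have hK4 : (4 : ℝ) ≤ max K₀ 4 := le_max_right _ _
  -- the polar part
  have hpole : ‖(s - 1)⁻¹‖ ≤ 1 / (1 - α) := by
    rw [norm_inv, one_div]
    refine inv_anti₀ (by linarith) ?_
    have := Complex.abs_re_le_norm (s - 1)
    rw [sub_re, hsre, one_re, abs_of_neg (by linarith)] at this
    linarith
  -- `ζ₀`
  have hζ₀ : ‖riemannZeta₀ s‖ ≤ max K₀ 4 * (1 + |t|) := by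
    rcases le_or_gt 1 |t| with ht | ht
    · have h := ZeroDetect.norm_riemannZeta₀_le (s := s) (by rw [hsre]; exact hα) (by rwa [hsim])
      have hns : ‖s‖ ≤ 1 + |t| := by
        calc ‖s‖ ≤ |s.re| + |s.im| := Complex.norm_le_abs_re_add_abs_im s
          _ = |α| + |t| := by rw [hsre, hsim]
          _ ≤ 1 + |t| := by rw [abs_of_pos (by linarith)]; linarith
      calc ‖riemannZeta₀ s‖ ≤ 3 * ‖s‖ + 1 := h
        _ ≤ 4 * (1 + |t|) := by linarith [abs_nonneg t]
        _ ≤ max K₀ 4 * (1 + |t|) := by gcongr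
    · have hmem : s ∈ Set.Icc (1 / 2 : ℝ) 1 ×ℂ Set.Icc (-1 : ℝ) 1 := by
        rw [Complex.mem_reProdIm, hsre, hsim]
        exact ⟨⟨hα, hα1.le⟩, ⟨by linarith [neg_abs_le t], by linarith [le_abs_self t]⟩⟩
      calc ‖riemannZeta₀ s‖ ≤ K₀ := hK₀ s hmem
        _ ≤ max K₀ 4 * 1 := by rw [mul_one]; exact le_max_left _ _
        _ ≤ max K₀ 4 * (1 + |t|) := by gcongr; linarith [abs_nonneg t]
  rw [riemannZeta_eq_inv_sub_add hs1]
  calc ‖(s - 1)⁻¹ + riemannZeta₀ s‖ ≤ ‖(s - 1)⁻¹‖ + ‖riemannZeta₀ s‖ := norm_add_le _ _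
    _ ≤ 1 / (1 - α) + max K₀ 4 * (1 + |t|) := add_le_add hpole hζ₀

end LineBounds

/-! ## Part A3. The per-zero dichotomy at level `α`; Class II is empty under a sup bound -/

section Dichotomy

/-- **Class I / Class II dichotomy at level `α`** (Ivić (11.9)–(11.10) with the line of (11.45)).
Let `1/2 ≤ α < σ`, `X ≥ 1`, `Y ≥ 4`, `X·2^J ≥ Y`, `U ≥ 1` with the residue condition
`2 Y^{1−σ} (1 + log X)/U³ ≤ 1/8`. Then every zero `ρ = β + iγ` of `ζ` with `β ≥ σ`, `U < γ ≤ 2U`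
(only the lower bound `γ > U` is used) satisfies either `|∑_{X<n≤X2^J} b(n) n^{−ρ}| ≥ 1/8`
(Class I, `b = ZeroDensity.coeffB X Y`) or
`∫_ℝ |K(α−β+iy)| |ζ(α+i(γ+y))| |M_X(α+i(γ+y))| dy ≥ (5π/8) Y^{σ−α}` (Class II).
[cite: Ivic1985, §11.2 (11.9)–(11.10) and §11.4 (11.45)] -/
theorem perZero_dichotomy_line {σ α : ℝ} (hα : 1 / 2 ≤ α) (hασ : α < σ)
    {X Y J : ℕ} (hX : 1 ≤ X) (hY4 : 4 ≤ Y) (hJ : Y ≤ X * 2 ^ J) {U : ℝ} (hU : 1 ≤ U)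
    (hres : 2 * (Y : ℝ) ^ (1 - σ) * (1 + Real.log X) / U ^ 3 ≤ 1 / 8)
    {ρ : ℂ} (hζ : riemannZeta ρ = 0) (hβ : σ ≤ ρ.re) (hγ1 : U < ρ.im) :
    1 / 8 ≤ ‖∑ n ∈ Finset.Ioc X (X * 2 ^ J), ZeroDensity.coeffB X Y n * (n : ℂ) ^ (-ρ)‖ ∨
    5 * π / 8 * (Y : ℝ) ^ (σ - α) ≤ ∫ y : ℝ, ‖rieszK (((α - ρ.re : ℝ) : ℂ) + y * I)‖ *
        (‖riemannZeta (α + (ρ.im + y) * I)‖ * ‖mollifier X (α + (ρ.im + y) * I)‖) := by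
  have hY1 : 1 ≤ Y := by omega
  have hY0 : (0 : ℝ) < Y := by exact_mod_cast (by omega : 0 < Y)
  have hYr : (4 : ℝ) ≤ Y := by exact_mod_cast hY4
  have hβ1 : ρ.re < 1 := by
    by_contra h
    exact riemannZeta_ne_zero_of_one_le_re (not_lt.1 h) hζ
  have hαβ : α < ρ.re := lt_of_lt_of_le hασ hβ
  have hγ0 : 0 < ρ.im := by linarith
  have hU0 : 0 < U := by linarith
  have hD := zeroDetection_norm_ineq_line hX hY1 hα hαβ hβ1 hζ
  rw [ZeroDensity.sum_Ioc_eq_sum_coeffB (by omega) hJ] at hD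
  set S := ∑ n ∈ Finset.Ioc X (X * 2 ^ J), ZeroDensity.coeffB X Y n * (n : ℂ) ^ (-ρ) with hS
  set Iint := ∫ y : ℝ, ‖rieszK (((α - ρ.re : ℝ) : ℂ) + y * I)‖ *
    (‖riemannZeta (α + (ρ.im + y) * I)‖ * ‖mollifier X (α + (ρ.im + y) * I)‖) with hI
  have hI0 : 0 ≤ Iint := integral_nonneg fun y ↦ by positivity
  -- `(1 - 1/Y)² ≥ 9/16`
  have hlhs : (9 : ℝ) / 16 ≤ ((1 : ℝ) - 1 / Y) ^ 2 := by
    have h1 : (3 : ℝ) / 4 ≤ 1 - 1 / Y := by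
      rw [le_sub_comm, div_le_iff₀ hY0]; linarith
    nlinarith
  -- the residue term is `≤ 1/8`
  have hresid : (Y : ℝ) ^ (1 - ρ.re) * ‖rieszK (1 - ρ)‖ * (1 + Real.log X) ≤ 1 / 8 := by
    have h1 : (Y : ℝ) ^ (1 - ρ.re) ≤ (Y : ℝ) ^ (1 - σ) :=
      Real.rpow_le_rpow_of_exponent_le (by linarith) (by linarith)
    have h2 : ‖rieszK (1 - ρ)‖ ≤ 2 / U ^ 3 := by
      refine (ZeroDensity.norm_rieszK_one_sub_le hγ0).trans ?_
      exact div_le_div_of_nonneg_left (by norm_num) (by positivity)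
        (pow_le_pow_left₀ (by linarith) hγ1.le 3)
    have hlogX : 0 ≤ 1 + Real.log X := by
      have : 0 ≤ Real.log X := Real.log_nonneg (by exact_mod_cast hX)
      linarith
    calc (Y : ℝ) ^ (1 - ρ.re) * ‖rieszK (1 - ρ)‖ * (1 + Real.log X)
        ≤ (Y : ℝ) ^ (1 - σ) * (2 / U ^ 3) * (1 + Real.log X) := by
          refine mul_le_mul_of_nonneg_right
            (mul_le_mul h1 h2 (norm_nonneg _) (Real.rpow_nonneg hY0.le _)) hlogX
      _ = 2 * (Y : ℝ) ^ (1 - σ) * (1 + Real.log X) / U ^ 3 := by ring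
      _ ≤ 1 / 8 := hres
  by_cases hcase : 1 / 8 ≤ ‖S‖
  · exact Or.inl hcase
  · right
    rw [not_le] at hcase
    have hq : (5 : ℝ) / 16 ≤ 1 / (2 * π) * (Y : ℝ) ^ (α - ρ.re) * Iint := by linarith
    have hYpow : 0 < (Y : ℝ) ^ (ρ.re - α) := Real.rpow_pos_of_pos hY0 _
    have hinv : (Y : ℝ) ^ (α - ρ.re) = ((Y : ℝ) ^ (ρ.re - α))⁻¹ := by
      rw [← Real.rpow_neg hY0.le]; congr 1; ring
    have hIge : 5 * π / 8 * (Y : ℝ) ^ (ρ.re - α) ≤ Iint := by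
      rw [hinv] at hq
      have h2 : (5 : ℝ) / 16 * (2 * π * (Y : ℝ) ^ (ρ.re - α)) ≤
          (1 / (2 * π) * ((Y : ℝ) ^ (ρ.re - α))⁻¹ * Iint) * (2 * π * (Y : ℝ) ^ (ρ.re - α)) :=
        mul_le_mul_of_nonneg_right hq (by positivity)
      have e : (1 / (2 * π) * ((Y : ℝ) ^ (ρ.re - α))⁻¹ * Iint) * (2 * π * (Y : ℝ) ^ (ρ.re - α)) =
          Iint := by
        field_simp
      rw [e] at h2
      linarith
    have hYσ : (Y : ℝ) ^ (σ - α) ≤ (Y : ℝ) ^ (ρ.re - α) :=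
      Real.rpow_le_rpow_of_exponent_le (by linarith) (by linarith)
    nlinarith [Real.pi_pos]

/-- **The Class-II integral at level `α` under a sup bound.** Let `1/2 ≤ α < σ ≤ Re ρ < 1`,
`U < Im ρ ≤ 2U`, `U ≥ 1`, `X ≥ 1`; suppose `|ζ(α+it)| ≤ S` for `|t| ≤ 3U` and the crude bound
`|ζ(α'+it)| ≤ 1/(1−α') + K(1+|t|)` on `1/2 ≤ α' < 1` (`exists_norm_zeta_line_le`). If the full
Class-II integral is at least `A > 0`, then
`A ≤ (1 + X^{1−α}/(1−α)) · (2πS/(σ−α)² + π(4/(1−α) + 16K)/U)`: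
on `|y| ≤ U` one has `|Im| ≤ 3U`, `∫_{−U}^{U}|K(α−β+iy)|dy ≤ 2π/(σ−α)²`
(`ZeroDensity.integral_norm_rieszK_le`) and `|M_X| ≤ 1 + X^{1−α}/(1−α)`; on `|y| > U` the kernel
decay `|K| ≤ 2/|y|³` and the crude bound give the tail. [cite: Ivic1985, §11.2 (11.10) and §11.4 (11.45)] -/
theorem classTwo_integral_le_line {σ α S K : ℝ} (hα : 1 / 2 ≤ α) (hασ : α < σ)
    (hS0 : 0 ≤ S) (hK0 : 0 ≤ K) {X : ℕ} (hX : 1 ≤ X) {U : ℝ} (hU : 1 ≤ U)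
    (hS : ∀ t : ℝ, |t| ≤ 3 * U → ‖riemannZeta ((α : ℂ) + t * I)‖ ≤ S)
    (hK : ∀ α' t : ℝ, 1 / 2 ≤ α' → α' < 1 →
      ‖riemannZeta ((α' : ℂ) + t * I)‖ ≤ 1 / (1 - α') + K * (1 + |t|))
    {ρ : ℂ} (hβ : σ ≤ ρ.re) (hβ1 : ρ.re < 1) (hγ1 : U < ρ.im) (hγ2 : ρ.im ≤ 2 * U)
    {A : ℝ} (hA0 : 0 < A)
    (hA : A ≤ ∫ y : ℝ, ‖rieszK (((α - ρ.re : ℝ) : ℂ) + y * I)‖ *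
      (‖riemannZeta (α + (ρ.im + y) * I)‖ * ‖mollifier X (α + (ρ.im + y) * I)‖)) :
    A ≤ (1 + (X : ℝ) ^ (1 - α) / (1 - α)) *
      (2 * π * S / (σ - α) ^ 2 + π * (4 / (1 - α) + 16 * K) / U) := by
  have hα1 : α < 1 := by linarith
  have h1α : 0 < 1 - α := by linarith
  have hU0 : 0 < U := by linarith
  have hγ0 : 0 ≤ ρ.im := by linarith
  set η : ℝ := ρ.re - α with hη
  have hη0 : 0 < η := by rw [hη]; linarith
  have hη2 : η ≤ 1 / 2 := by rw [hη]; linarith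
  have haη : α - ρ.re = -η := by rw [hη]; ring
  set mX : ℝ := 1 + (X : ℝ) ^ (1 - α) / (1 - α) with hmX
  have hmX0 : 0 ≤ mX := by positivity
  set f : ℝ → ℝ := fun y ↦ ‖rieszK (((α - ρ.re : ℝ) : ℂ) + y * I)‖ *
      (‖riemannZeta (α + (ρ.im + y) * I)‖ * ‖mollifier X (α + (ρ.im + y) * I)‖) with hf
  have hf0 : ∀ y, 0 ≤ f y := fun y ↦ by positivity
  -- integrability is forced by `A > 0`
  have hint : Integrable f := by
    by_contra h
    rw [integral_undef h] at hA
    linarith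
  -- the mollifier and the kernel
  have hM : ∀ y : ℝ, ‖mollifier X ((α : ℂ) + (ρ.im + y) * I)‖ ≤ mX := by
    intro y
    have h := norm_mollifier_le_rpow hX (s := (α : ℂ) + (ρ.im + y) * I) (by simp; linarith)
      (by simp; linarith)
    simpa [hmX] using h
  have hKc : Continuous fun y : ℝ ↦ ‖rieszK (((α - ρ.re : ℝ) : ℂ) + y * I)‖ := by
    rw [haη]; exact ZeroDensity.continuous_norm_rieszK_neg_line hη0 hη2
  -- split at `|y| ≤ U`
  set s : Set ℝ := Set.Icc (-U) U with hs
  have hsm : MeasurableSet s := measurableSet_Icc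
  have hsplit : ∫ y, f y = (∫ y in s, f y) + ∫ y in sᶜ, f y := (integral_add_compl hsm hint).symm
  -- the piece `|y| ≤ U`
  have hin : ∫ y in s, f y ≤ mX * (2 * π * S / (σ - α) ^ 2) := by
    have hpt : ∀ y ∈ s, f y ≤ (S * mX) * ‖rieszK (((α - ρ.re : ℝ) : ℂ) + y * I)‖ := by
      intro y hy
      have hy1 : -U ≤ y := hy.1
      have hy2 : y ≤ U := hy.2
      have hζ : ‖riemannZeta ((α : ℂ) + (ρ.im + y) * I)‖ ≤ S := by
        have h1 := hS (ρ.im + y) (abs_le.2 ⟨by linarith, by linarith⟩)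
        push_cast at h1
        exact h1
      simp only [hf]
      rw [mul_comm]
      refine mul_le_mul_of_nonneg_right ?_ (norm_nonneg _)
      exact mul_le_mul hζ (hM y) (norm_nonneg _) hS0
    have hIK : IntegrableOn (fun y : ℝ ↦ (S * mX) * ‖rieszK (((α - ρ.re : ℝ) : ℂ) + y * I)‖) s :=
      (hKc.const_mul _).integrableOn_Icc
    calc ∫ y in s, f y ≤ ∫ y in s, (S * mX) * ‖rieszK (((α - ρ.re : ℝ) : ℂ) + y * I)‖ :=
          setIntegral_mono_on hint.integrableOn hIK hsm hpt
      _ = (S * mX) * ∫ y in (-U)..U, ‖rieszK (((α - ρ.re : ℝ) : ℂ) + y * I)‖ := by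
          rw [integral_const_mul, intervalIntegral.integral_of_le (by linarith), hs,
            integral_Icc_eq_integral_Ioc]
      _ ≤ (S * mX) * (2 * π / (σ - α) ^ 2) := by
          refine mul_le_mul_of_nonneg_left ?_ (by positivity)
          have h := ZeroDensity.integral_norm_rieszK_le (η₀ := σ - α) (η := η) (by linarith)
            (by rw [hη]; linarith) hη2 hU0.le
          rw [haη]; exact h
      _ = mX * (2 * π * S / (σ - α) ^ 2) := by ring
  -- the tail `|y| > U`
  set P : ℝ := 1 / (1 - α) + K * (1 + 2 * U) with hP
  have hP0 : 0 ≤ P := by positivity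
  set g : ℝ → ℝ := fun y ↦ mX * (4 * P / U + 4 * K) * (U ^ 2 + y ^ 2)⁻¹ with hg
  have hgint : Integrable g :=
    (Literature.NumberTheory.LFunctions.RieszPerron.integrable_inv_sq_add_sq hU0.ne').const_mul _
  have hg0 : ∀ y, 0 ≤ g y := fun y ↦ by positivity
  have hfg : ∀ y ∈ sᶜ, f y ≤ g y := by
    intro y hy
    have hyU : U < |y| := by
      simp only [hs, Set.mem_compl_iff, Set.mem_Icc, not_and_or, not_le] at hy
      rcases hy with hy | hy
      · rw [abs_of_neg (by linarith)]; linarith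
      · rw [abs_of_pos (by linarith)]; exact hy
    have hy0 : y ≠ 0 := fun h ↦ by rw [h, abs_zero] at hyU; linarith
    have hyp : 0 < |y| := abs_pos.2 hy0
    have hKy := ZeroDensity.norm_rieszK_le_two_div_cube (α - ρ.re) hy0
    have hζ : ‖riemannZeta ((α : ℂ) + (ρ.im + y) * I)‖ ≤ P + K * |y| := by
      have h1 := hK α (ρ.im + y) hα hα1
      push_cast at h1
      have hγy : |ρ.im + y| ≤ 2 * U + |y| :=
        (abs_add_le _ _).trans (by rw [abs_of_nonneg hγ0]; linarith)
      calc ‖riemannZeta ((α : ℂ) + (ρ.im + y) * I)‖ ≤ 1 / (1 - α) + K * (1 + |ρ.im + y|) := h1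
        _ ≤ 1 / (1 - α) + K * (1 + (2 * U + |y|)) := by gcongr
        _ = P + K * |y| := by rw [hP]; ring
    have h1 : f y ≤ 2 / |y| ^ 3 * ((P + K * |y|) * mX) := by
      simp only [hf]
      exact mul_le_mul hKy (mul_le_mul hζ (hM y) (norm_nonneg _) (by positivity))
        (by positivity) (by positivity)
    refine h1.trans ?_
    -- `2(P + K|y|) mX/|y|³ ≤ mX (4P/U + 4K)/(U² + y²)` for `|y| > U ≥ 1`
    simp only [hg]
    have hy2 : U ^ 2 + y ^ 2 ≤ 2 * |y| ^ 2 := by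
      have h := pow_lt_pow_left₀ hyU (by linarith) two_ne_zero
      rw [sq_abs] at h ⊢
      linarith
    have hpos : 0 < U ^ 2 + y ^ 2 := by positivity
    have hy3 : 0 < |y| ^ 3 := by positivity
    rw [div_mul_eq_mul_div, div_le_iff₀ hy3,
      show mX * (4 * P / U + 4 * K) * (U ^ 2 + y ^ 2)⁻¹ * |y| ^ 3 =
        mX * ((4 * P / U + 4 * K) * |y| ^ 3) / (U ^ 2 + y ^ 2) by ring,
      le_div_iff₀ hpos]
    have hPU : P * (U ^ 2 + y ^ 2) ≤ 2 * P / U * |y| ^ 3 := by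
      rw [show 2 * P / U * |y| ^ 3 = P * (2 * |y| ^ 2 * |y| / U) by ring]
      refine mul_le_mul_of_nonneg_left ?_ hP0
      rw [le_div_iff₀ hU0]
      calc (U ^ 2 + y ^ 2) * U ≤ (2 * |y| ^ 2) * |y| :=
            mul_le_mul hy2 hyU.le hU0.le (by positivity)
        _ = 2 * |y| ^ 2 * |y| := by ring
    have hKU : K * |y| * (U ^ 2 + y ^ 2) ≤ 2 * K * |y| ^ 3 := by
      calc K * |y| * (U ^ 2 + y ^ 2) ≤ K * |y| * (2 * |y| ^ 2) := by gcongr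
        _ = 2 * K * |y| ^ 3 := by ring
    calc 2 * ((P + K * |y|) * mX) * (U ^ 2 + y ^ 2)
        = 2 * mX * (P * (U ^ 2 + y ^ 2) + K * |y| * (U ^ 2 + y ^ 2)) := by ring
      _ ≤ 2 * mX * (2 * P / U * |y| ^ 3 + 2 * K * |y| ^ 3) := by gcongr
      _ = mX * ((4 * P / U + 4 * K) * |y| ^ 3) := by ring
  have htail : ∫ y in sᶜ, f y ≤ mX * (π * (4 / (1 - α) + 16 * K) / U) := by
    calc ∫ y in sᶜ, f y ≤ ∫ y in sᶜ, g y :=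
          setIntegral_mono_on hint.integrableOn hgint.integrableOn hsm.compl hfg
      _ ≤ ∫ y, g y := setIntegral_le_integral hgint (Eventually.of_forall hg0)
      _ = mX * (4 * P / U + 4 * K) * (π / U) := by
          simp only [hg]
          rw [integral_const_mul, ZeroDensity.integral_inv_sq_add_sq_real hU0]
      _ ≤ mX * (4 / (1 - α) + 16 * K) * (π / U) := by
          have hPU' : 4 * P / U + 4 * K ≤ 4 / (1 - α) + 16 * K := by
            rw [hP]
            have h1 : 4 * (1 / (1 - α) + K * (1 + 2 * U)) / U =
                4 / (1 - α) / U + 4 * K * ((1 + 2 * U) / U) := by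
              field_simp
            rw [h1]
            have h2 : 4 / (1 - α) / U ≤ 4 / (1 - α) := div_le_self (by positivity) hU
            have h3 : (1 + 2 * U) / U ≤ 3 := by
              rw [div_le_iff₀ hU0]; linarith
            nlinarith
          gcongr
      _ = mX * (π * (4 / (1 - α) + 16 * K) / U) := by ring
  rw [hsplit] at hA
  calc A ≤ (∫ y in s, f y) + ∫ y in sᶜ, f y := hA
    _ ≤ mX * (2 * π * S / (σ - α) ^ 2) + mX * (π * (4 / (1 - α) + 16 * K) / U) :=
        add_le_add hin htail
    _ = mX * (2 * π * S / (σ - α) ^ 2 + π * (4 / (1 - α) + 16 * K) / U) := by ring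

/-- **Every zero is of Class I at level `α`** once `Y^{σ−α}` beats the sup bound (Ivić's choice
(11.51) of `Y`, here in the form "Class II is empty", as in `HalaszTuranLH.classOne_of_sup`):
under the hypotheses of `perZero_dichotomy_line`, a sup bound `|ζ(α+it)| ≤ S` (`|t| ≤ 3U`), the
crude bound of `exists_norm_zeta_line_le` with constant `K`, and
`(1 + X^{1−α}/(1−α)) (2πS/(σ−α)² + π(4/(1−α)+16K)/U) < (5π/8) Y^{σ−α}`, every zero `ρ` with
`Re ρ ≥ σ`, `U < Im ρ ≤ 2U` has `|∑_{X<n≤X2^J} b(n) n^{−ρ}| ≥ 1/8`.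
[cite: Ivic1985, §11.4 (11.45) and (11.51)] -/
theorem classOne_of_sup_line {σ α S K : ℝ} (hα : 1 / 2 ≤ α) (hασ : α < σ)
    (hS0 : 0 ≤ S) (hK0 : 0 ≤ K) {X Y J : ℕ} (hX : 1 ≤ X) (hY4 : 4 ≤ Y) (hJ : Y ≤ X * 2 ^ J)
    {U : ℝ} (hU : 1 ≤ U)
    (hres : 2 * (Y : ℝ) ^ (1 - σ) * (1 + Real.log X) / U ^ 3 ≤ 1 / 8)
    (hS : ∀ t : ℝ, |t| ≤ 3 * U → ‖riemannZeta ((α : ℂ) + t * I)‖ ≤ S)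
    (hK : ∀ α' t : ℝ, 1 / 2 ≤ α' → α' < 1 →
      ‖riemannZeta ((α' : ℂ) + t * I)‖ ≤ 1 / (1 - α') + K * (1 + |t|))
    (hkill : (1 + (X : ℝ) ^ (1 - α) / (1 - α)) *
      (2 * π * S / (σ - α) ^ 2 + π * (4 / (1 - α) + 16 * K) / U) <
        5 * π / 8 * (Y : ℝ) ^ (σ - α))
    {ρ : ℂ} (hζ : riemannZeta ρ = 0) (hβ : σ ≤ ρ.re) (hγ1 : U < ρ.im) (hγ2 : ρ.im ≤ 2 * U) :
    1 / 8 ≤ ‖∑ n ∈ Finset.Ioc X (X * 2 ^ J), ZeroDensity.coeffB X Y n * (n : ℂ) ^ (-ρ)‖ := by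
  have hβ1 : ρ.re < 1 := by
    by_contra h
    exact riemannZeta_ne_zero_of_one_le_re (not_lt.1 h) hζ
  have hY0 : (0 : ℝ) < Y := by exact_mod_cast (by omega : 0 < Y)
  rcases perZero_dichotomy_line hα hασ hX hY4 hJ hU hres hζ hβ hγ1 with hd | hd
  · exact hd
  · exfalso
    have hA0 : 0 < 5 * π / 8 * (Y : ℝ) ^ (σ - α) := by positivity
    have := classTwo_integral_le_line hα hασ hS0 hK0 hX hU hS hK hβ hβ1 hγ1 hγ2 hA0 hd
    linarith

end Dichotomy

/-! ## Part A4. The smoothed Halász–Montgomery kernel with the line moved to `Re w = α` -/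

section Kernel

/-- **The smoothed kernel moved to the line `Re w = α`** (`1/2 ≤ α < 1`; Perron's formula on
`Re w = 5/2` shifted to `Re w = α`; the only pole crossed is that of `ζ(iτ + w)` at
`w = 1 − iτ`, with residue `Y^{1−iτ} K(1−iτ)`): for `Y ≥ 1` and `|τ| ≥ 1`,
`∑_{n≤Y} (1 − n/Y)² n^{−iτ} = Y^{1−iτ}K(1−iτ) + (1/2π)∫ Y^{α+iv}K(α+iv)ζ(α + i(τ+v)) dv`, the line
integrand being integrable (Ivić (11.36)–(11.37) with the Riesz kernel in place of `Γ`, as in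
`HalaszTuranLH.smoothedKernel_identity` where `α = 1/2`). [cite: Ivic1985, §11.4 (11.36)–(11.37) and (11.46)] -/
theorem smoothedKernel_identity_line {Y : ℕ} (hY : 1 ≤ Y) {α : ℝ} (hα : 1 / 2 ≤ α) (hα1 : α < 1)
    {τ : ℝ} (hτ : 1 ≤ |τ|) :
    Integrable (fun v : ℝ ↦ (Y : ℂ) ^ ((α : ℂ) + v * I) *
        rieszK ((α : ℂ) + v * I) * riemannZeta (α + ((τ : ℂ) + v) * I)) ∧
    ∑ n ∈ Finset.Icc 1 Y, ((((1 : ℝ) - (n : ℝ) / Y) ^ 2 : ℝ) : ℂ) * (n : ℂ) ^ (-((τ : ℂ) * I)) =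
      (Y : ℂ) ^ (1 - (τ : ℂ) * I) * rieszK (1 - (τ : ℂ) * I) +
      ((1 / (2 * π) : ℝ) : ℂ) * ∫ v : ℝ, (Y : ℂ) ^ ((α : ℂ) + v * I) *
        rieszK ((α : ℂ) + v * I) * riemannZeta (α + ((τ : ℂ) + v) * I) := by
  have hY0 : 0 < Y := hY
  have hYc : (Y : ℂ) ≠ 0 := by exact_mod_cast hY0.ne'
  have hα0 : 0 < α := by linarith
  set s : ℂ := (τ : ℂ) * I with hs_def
  have hsre : s.re = 0 := by simp [hs_def]
  have hsim : s.im = τ := by simp [hs_def]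
  set z₁ : ℂ := 1 - s with hz₁_def
  have hz₁re : z₁.re = 1 := by simp [hz₁_def, hsre]
  have hz₁im : z₁.im = -τ := by simp [hz₁_def, hsim]
  have hz₁0 : z₁ ≠ 0 := fun h ↦ by have := congrArg Complex.re h; rw [hz₁re] at this; simp at this
  have hz₁1 : z₁ + 1 ≠ 0 := fun h ↦ by
    have := congrArg Complex.re h; rw [add_re, hz₁re] at this; norm_num at this
  have hz₁2 : z₁ + 2 ≠ 0 := fun h ↦ by
    have := congrArg Complex.re h; rw [add_re, hz₁re] at this; norm_num at this
  set P : ℂ → ℂ := fun z ↦ (Y : ℂ) ^ z * rieszK z * riemannZeta (s + z) with hP_def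
  set f : ℂ → ℂ := fun z ↦ (Y : ℂ) ^ z with hf_def
  set F : ℂ → ℂ := fun z ↦ rieszK z *
    ((Y : ℂ) ^ z * riemannZeta₀ (s + z) + dslope f z₁ z) with hF_def
  set A : ℂ := f z₁ / z₁ with hA_def
  -- Step 1: Perron on `Re z = 5/2`
  have hPerron := HalaszTuranLH.smoothedKernel_eq_perron hY0 τ
  have hG : ∀ y : ℝ, (Y : ℂ) ^ (((5 / 2 : ℝ) : ℂ) + y * I) *
      rieszK (((5 / 2 : ℝ) : ℂ) + y * I) * riemannZeta ((τ : ℂ) * I + (((5 / 2 : ℝ) : ℂ) + y * I)) =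
      P (((5 / 2 : ℝ) : ℂ) + y * I) := fun y ↦ by simp only [hP_def, hs_def]
  simp_rw [hG] at hPerron
  -- Step 2: the pointwise decomposition off the poles
  have hdec : ∀ (c : ℝ), 0 < c → c ≠ 1 → ∀ y : ℝ,
      P ((c : ℂ) + y * I) = F ((c : ℂ) + y * I) +
        A * (rieszKt ((c : ℂ) + y * I) / (((c : ℂ) + y * I) - z₁) -
          rieszKt ((c : ℂ) + y * I) / (((c : ℂ) + y * I) - 0)) := by
    intro c hc0 hc1 y
    set z : ℂ := (c : ℂ) + y * I with hz
    have hzre : z.re = c := by simp [hz]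
    have h0 : z ≠ 0 := fun h ↦ by have := congrArg Complex.re h; rw [hzre] at this; simp at this; linarith
    have h1 : z + 1 ≠ 0 := fun h ↦ by
      have := congrArg Complex.re h; rw [add_re, hzre] at this; simp at this; linarith
    have h2 : z + 2 ≠ 0 := fun h ↦ by
      have := congrArg Complex.re h; rw [add_re, hzre] at this; simp at this; linarith
    have hzz : z - z₁ ≠ 0 := fun h ↦ by
      have := congrArg Complex.re h; rw [sub_re, hzre, hz₁re] at this; simp at this; exact hc1 (by linarith)
    have hzz' : z ≠ z₁ := sub_ne_zero.1 hzz
    have hsz : s + z ≠ 1 := fun h ↦ by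
      have := congrArg Complex.re h; rw [add_re, hsre, hzre] at this; simp at this; exact hc1 (by linarith)
    have hsz1 : s + z - 1 = z - z₁ := by rw [hz₁_def]; ring
    have hK := HalaszTuranLH.rieszK_eq_rieszKt_div h0 h1 h2
    have hζ := riemannZeta_eq_inv_sub_add hsz
    have hds : dslope f z₁ z = (z - z₁)⁻¹ * (f z - f z₁) := by
      rw [dslope_of_ne f hzz', slope_def_module, smul_eq_mul]
    simp only [hP_def, hF_def, hA_def]
    rw [hζ, hsz1, hds, hK, sub_zero]
    simp only [hf_def]
    field_simp
    ring
  -- Step 3: `F` is holomorphic on `Re z > 0`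
  have hOpen : IsOpen {z : ℂ | 0 < z.re} := isOpen_lt continuous_const Complex.continuous_re
  have hf : Differentiable ℂ f := by
    simp only [hf_def]; exact differentiable_id.const_cpow (Or.inl hYc)
  have hg : Differentiable ℂ (fun z : ℂ ↦ (Y : ℂ) ^ z * riemannZeta₀ (s + z)) :=
    (differentiable_id.const_cpow (Or.inl hYc)).mul
      (differentiable_riemannZeta₀.comp (differentiable_id.const_add s))
  have hds : DifferentiableOn ℂ (dslope f z₁) {z : ℂ | 0 < z.re} :=
    (Complex.differentiableOn_dslope (hOpen.mem_nhds (by simp [hz₁re]))).2 hf.differentiableOn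
  have hFd : DifferentiableOn ℂ F {z : ℂ | 0 < z.re} := by
    intro z hz
    simp only [hF_def]
    exact ((HalaszTuranLH.differentiableAt_rieszK hz).differentiableWithinAt).mul
      (((hg z).differentiableWithinAt).add (hds z hz))
  -- Step 4: the bound `‖F(σ + iT)‖ ≤ 22 Y^{5/2} / T²` on the strip `[α, 5/2]`, `|T| ≥ |τ| + 2`
  have hbound : ∀ σ' ∈ Set.Icc α (5 / 2), ∀ T : ℝ, |τ| + 2 ≤ |T| →
      ‖F (σ' + T * I)‖ ≤ 22 * (Y : ℝ) ^ (5 / 2 : ℝ) / T ^ 2 := by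
    intro σ' hσ' T hT
    obtain ⟨hσ1, hσ2⟩ := hσ'
    have hσ1' : 1 / 2 ≤ σ' := hα.trans hσ1
    set z : ℂ := (σ' : ℂ) + T * I with hz
    have hzre : z.re = σ' := by simp [hz]
    have hzim : z.im = T := by simp [hz]
    have hT3 : 3 ≤ |T| := by linarith
    have hT0 : T ≠ 0 := fun h ↦ by rw [h, abs_zero] at hT3; linarith
    have hTpos : 0 < |T| := abs_pos.2 hT0
    set W : ℝ := (Y : ℝ) ^ (5 / 2 : ℝ) with hW
    have hW0 : 0 ≤ W := by positivity
    have hK : ‖rieszK z‖ ≤ 2 / |T| ^ 3 := by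
      simpa [hz] using ZeroDensity.norm_rieszK_le_two_div_cube σ' (y := T) hT0
    have hYz : ‖(Y : ℂ) ^ z‖ ≤ W := ZeroDetect.norm_natCast_cpow_le hY (by rw [hzre]; exact hσ2)
    have hYz₁ : ‖f z₁‖ ≤ W := by
      simp only [hf_def]; exact ZeroDetect.norm_natCast_cpow_le hY (by rw [hz₁re]; norm_num)
    have hsz_re : (s + z).re = σ' := by rw [add_re, hsre, hzre]; ring
    have hsz_im : (s + z).im = τ + T := by rw [add_im, hsim, hzim]
    have hτT : 2 ≤ |τ + T| := by
      have := abs_sub_abs_le_abs_sub T (-τ)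
      rw [abs_neg, show T - -τ = τ + T by ring] at this
      linarith
    have hζ₀ : ‖riemannZeta₀ (s + z)‖ ≤ 10 * |T| := by
      have h := ZeroDetect.norm_riemannZeta₀_le (s := s + z) (by rw [hsz_re]; exact hσ1')
        (by rw [hsz_im]; linarith)
      have hn : ‖s + z‖ ≤ 3 * |T| := by
        calc ‖s + z‖ ≤ |(s + z).re| + |(s + z).im| := Complex.norm_le_abs_re_add_abs_im _
          _ = |σ'| + |τ + T| := by rw [hsz_re, hsz_im]
          _ ≤ σ' + (|τ| + |T|) := by
              rw [abs_of_pos (by linarith)]; exact add_le_add le_rfl (abs_add_le _ _)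
          _ ≤ 3 * |T| := by linarith
      linarith
    have hzz : z ≠ z₁ := fun h ↦ by
      have := congrArg Complex.im h
      rw [hzim, hz₁im] at this
      rw [this, show τ + -τ = 0 by ring, abs_zero] at hτT
      linarith
    have hdsl : ‖dslope f z₁ z‖ ≤ W := by
      have h := ZeroDetect.norm_dslope_le f hzz
      have hden : 2 ≤ ‖z - z₁‖ := by
        have := Complex.abs_im_le_norm (z - z₁)
        rw [sub_im, hzim, hz₁im, show T - -τ = τ + T by ring] at this
        linarith
      have hfz : ‖f z‖ ≤ W := by simp only [hf_def]; exact hYz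
      calc ‖dslope f z₁ z‖ ≤ (‖f z‖ + ‖f z₁‖) / ‖z - z₁‖ := h
        _ ≤ (W + W) / 2 := by
            rw [div_le_div_iff₀ (by linarith) (by norm_num)]
            nlinarith [norm_nonneg (f z), norm_nonneg (f z₁)]
        _ = W := by ring
    have hinner : ‖(Y : ℂ) ^ z * riemannZeta₀ (s + z) + dslope f z₁ z‖ ≤ 11 * W * |T| := by
      calc ‖(Y : ℂ) ^ z * riemannZeta₀ (s + z) + dslope f z₁ z‖
          ≤ ‖(Y : ℂ) ^ z‖ * ‖riemannZeta₀ (s + z)‖ + ‖dslope f z₁ z‖ := by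
            rw [← norm_mul]; exact norm_add_le _ _
        _ ≤ W * (10 * |T|) + W := add_le_add (mul_le_mul hYz hζ₀ (norm_nonneg _) hW0) hdsl
        _ ≤ W * (10 * |T|) + W * |T| := by nlinarith
        _ = 11 * W * |T| := by ring
    have hFz : F z = rieszK z * ((Y : ℂ) ^ z * riemannZeta₀ (s + z) + dslope f z₁ z) := by
      simp only [hF_def]
    rw [hFz, norm_mul]
    calc ‖rieszK z‖ * ‖(Y : ℂ) ^ z * riemannZeta₀ (s + z) + dslope f z₁ z‖
        ≤ 2 / |T| ^ 3 * (11 * W * |T|) := mul_le_mul hK hinner (norm_nonneg _) (by positivity)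
      _ = 22 * W / T ^ 2 := by
          have hT2 : T ^ 2 = |T| ^ 2 := (sq_abs T).symm
          rw [hT2]
          field_simp
          ring
  -- Step 5: decay, integrability, and Cauchy's theorem between the two lines
  have hR : 1 ≤ |τ| + 2 := by linarith [abs_nonneg τ]
  have hα52 : α ≤ 5 / 2 := by linarith
  obtain ⟨hdecay, hint⟩ := ZeroDetect.decay_and_integrable_of_sq_bound (F := F) (a := α) (b := 5 / 2)
    (C := 22 * (Y : ℝ) ^ (5 / 2 : ℝ)) (R := |τ| + 2) (by positivity) hR hbound
  have hcont : ∀ σ' ∈ Set.Icc α (5 / 2), Continuous fun y : ℝ ↦ F (σ' + y * I) := by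
    intro σ' hσ'
    refine hFd.continuousOn.comp_continuous (by fun_prop) fun y ↦ ?_
    show 0 < ((σ' : ℂ) + y * I).re
    simp; linarith [hσ'.1]
  have hIa : Integrable fun y : ℝ ↦ F ((α : ℝ) + y * I) :=
    hint α ⟨le_rfl, hα52⟩ (hcont _ ⟨le_rfl, hα52⟩)
  have hIb : Integrable fun y : ℝ ↦ F ((5 / 2 : ℝ) + y * I) :=
    hint (5 / 2) ⟨hα52, le_rfl⟩ (hcont _ ⟨hα52, le_rfl⟩)
  have hCauchy : ∫ y : ℝ, F ((α : ℝ) + y * I) = ∫ y : ℝ, F ((5 / 2 : ℝ) + y * I) := by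
    refine Literature.NumberTheory.LFunctions.MertensBoundRH.integral_vertical_eq_of_tendsto F
      (a := α) (b := 5 / 2) hα52 (hFd.mono ?_) hIa hIb hdecay
    intro z hz
    rw [Complex.mem_reProdIm] at hz
    show 0 < z.re
    linarith [hz.1.1]
  -- Step 6: the explicit pieces `K̃(z)/(z - z₁)`, `K̃(z)/(z - 0)` on the two lines
  have hz₁m : -1 < z₁.re := by rw [hz₁re]; norm_num
  have h0m : -1 < (0 : ℂ).re := by norm_num
  have hαm : -1 < α := by linarith
  have hαz₁ : α ≠ z₁.re := by rw [hz₁re]; exact hα1.ne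
  have hα0' : α ≠ (0 : ℂ).re := by simp; exact hα0.ne'
  have hIKa₁ := integrable_rieszKt_div_sub_line (z₁ := z₁) (c := α) hαm hαz₁ hz₁m
  have hIKa₀ := integrable_rieszKt_div_sub_line (z₁ := 0) (c := α) hαm hα0' h0m
  have hIKb₁ := integrable_rieszKt_div_sub_line (z₁ := z₁) (c := 5 / 2) (by norm_num)
    (by rw [hz₁re]; norm_num) hz₁m
  have hIKb₀ := integrable_rieszKt_div_sub_line (z₁ := 0) (c := 5 / 2) (by norm_num)
    (by norm_num) h0m
  have hVKa₁ := integral_rieszKt_div_sub_line (z₁ := z₁) (c := α) hαm hαz₁ hz₁m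
  have hVKa₀ := integral_rieszKt_div_sub_line (z₁ := 0) (c := α) hαm hα0' h0m
  have hVKb₁ := integral_rieszKt_div_sub_line (z₁ := z₁) (c := 5 / 2) (by norm_num)
    (by rw [hz₁re]; norm_num) hz₁m
  have hVKb₀ := integral_rieszKt_div_sub_line (z₁ := 0) (c := 5 / 2) (by norm_num)
    (by norm_num) h0m
  rw [if_neg (by rw [hz₁re]; exact not_lt.2 hα1.le)] at hVKa₁
  rw [if_pos (by simp; exact hα0)] at hVKa₀
  rw [if_pos (by rw [hz₁re]; norm_num)] at hVKb₁
  rw [if_pos (by norm_num)] at hVKb₀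
  -- Step 7: the integral on `Re z = 5/2` equals `∫ F`
  have hdec_b : (fun y : ℝ ↦ P (((5 / 2 : ℝ) : ℂ) + y * I)) = fun y : ℝ ↦
      F (((5 / 2 : ℝ) : ℂ) + y * I) + A * (rieszKt (((5 / 2 : ℝ) : ℂ) + y * I) /
        ((((5 / 2 : ℝ) : ℂ) + y * I) - z₁) -
          rieszKt (((5 / 2 : ℝ) : ℂ) + y * I) / ((((5 / 2 : ℝ) : ℂ) + y * I) - 0)) := by
    funext y; exact hdec (5 / 2) (by norm_num) (by norm_num) y
  have hdec_a : (fun y : ℝ ↦ P ((α : ℂ) + y * I)) = fun y : ℝ ↦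
      F ((α : ℂ) + y * I) + A * (rieszKt ((α : ℂ) + y * I) /
        (((α : ℂ) + y * I) - z₁) -
          rieszKt ((α : ℂ) + y * I) / (((α : ℂ) + y * I) - 0)) := by
    funext y; exact hdec α hα0 hα1.ne y
  have hIKb : Integrable fun y : ℝ ↦ rieszKt (((5 / 2 : ℝ) : ℂ) + y * I) /
      ((((5 / 2 : ℝ) : ℂ) + y * I) - z₁) -
        rieszKt (((5 / 2 : ℝ) : ℂ) + y * I) / ((((5 / 2 : ℝ) : ℂ) + y * I) - 0) :=
    hIKb₁.sub hIKb₀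
  have hIKa : Integrable fun y : ℝ ↦ rieszKt ((α : ℂ) + y * I) /
      (((α : ℂ) + y * I) - z₁) -
        rieszKt ((α : ℂ) + y * I) / (((α : ℂ) + y * I) - 0) :=
    hIKa₁.sub hIKa₀
  have hIntb : ∫ y : ℝ, P (((5 / 2 : ℝ) : ℂ) + y * I) = ∫ y : ℝ, F (((5 / 2 : ℝ) : ℂ) + y * I) := by
    rw [hdec_b, integral_add hIb (hIKb.const_mul A), integral_const_mul,
      integral_sub hIKb₁ hIKb₀, hVKb₁, hVKb₀]
    ring
  have hIPa : Integrable fun y : ℝ ↦ P ((α : ℂ) + y * I) := by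
    rw [hdec_a]; exact hIa.add (hIKa.const_mul A)
  have hInta : ∫ y : ℝ, P ((α : ℂ) + y * I) =
      (∫ y : ℝ, F ((α : ℂ) + y * I)) - A * ((2 * π) * rieszKt z₁) := by
    rw [hdec_a, integral_add hIa (hIKa.const_mul A), integral_const_mul,
      integral_sub hIKa₁ hIKa₀, hVKa₁, hVKa₀]
    ring
  -- Step 8: the residue `A · 2π K̃(z₁) = 2π · Y^{z₁} K(z₁)`
  have hres : A * ((2 * π) * rieszKt z₁) =
      (2 * π) * ((Y : ℂ) ^ (1 - (τ : ℂ) * I) * rieszK (1 - (τ : ℂ) * I)) := by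
    have hK : rieszK z₁ = rieszKt z₁ / z₁ :=
      HalaszTuranLH.rieszK_eq_rieszKt_div hz₁0 hz₁1 hz₁2
    rw [show (1 : ℂ) - (τ : ℂ) * I = z₁ by rw [hz₁_def], hK, hA_def, hf_def]
    field_simp
  -- Step 9: the line `Re z = α` in the stated form
  have hPa : ∀ y : ℝ, P ((α : ℂ) + y * I) = (Y : ℂ) ^ ((α : ℂ) + y * I) *
      rieszK ((α : ℂ) + y * I) * riemannZeta (α + ((τ : ℂ) + y) * I) := by
    intro y
    simp only [hP_def, hs_def]
    congr 2
    ring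
  refine ⟨by simp_rw [hPa] at hIPa; exact hIPa, ?_⟩
  rw [hPerron, hIntb, ← hCauchy, show (∫ y : ℝ, F ((α : ℂ) + y * I)) =
      (∫ y : ℝ, P ((α : ℂ) + y * I)) + A * ((2 * π) * rieszKt z₁) by
    rw [hInta]; ring, hres]
  simp_rw [hPa]
  generalize (∫ y : ℝ, (Y : ℂ) ^ ((α : ℂ) + y * I) *
      rieszK ((α : ℂ) + y * I) * riemannZeta (α + ((τ : ℂ) + y) * I)) = J
  have hπ : (π : ℂ) ≠ 0 := by exact_mod_cast Real.pi_ne_zero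
  push_cast
  field_simp
  ring

/-- `‖K(α + iv)‖ ≤ 4/(1/4 + v²)` for `α ≥ 1/2` (distance `≥ 1/2` from the poles `0, −1, −2`).
[folklore] -/
private theorem norm_rieszK_line_le {α : ℝ} (hα : 1 / 2 ≤ α) (v : ℝ) :
    ‖rieszK ((α : ℂ) + v * I)‖ ≤ 4 * ((1 / 2 : ℝ) ^ 2 + v ^ 2)⁻¹ := by
  have h := Literature.NumberTheory.LFunctions.RieszPerron.norm_Kfun_le (σ := α) (m := 1 / 2)
    (by norm_num) (by rw [abs_of_pos (by linarith)]; exact hα)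
    (by rw [abs_of_pos (by linarith)]; linarith) (by rw [abs_of_pos (by linarith)]; linarith) v
  calc ‖rieszK ((α : ℂ) + v * I)‖
      = ‖((1 : ℂ) / (α + v * I) - 2 / ((α + v * I) + 1) + 1 / ((α + v * I) + 2))‖ := rfl
    _ ≤ 2 / (1 / 2 * ((1 / 2 : ℝ) ^ 2 + v ^ 2)) := h
    _ = 4 * ((1 / 2 : ℝ) ^ 2 + v ^ 2)⁻¹ := by
        have : (0 : ℝ) < (1 / 2 : ℝ) ^ 2 + v ^ 2 := by positivity
        field_simp
        ring

/-- `v ↦ ‖K(α + iv)‖` is integrable on `ℝ` (`α ≥ 1/2`). [folklore] -/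
private theorem integrable_norm_rieszK_line {α : ℝ} (hα : 1 / 2 ≤ α) :
    Integrable fun v : ℝ ↦ ‖rieszK ((α : ℂ) + v * I)‖ := by
  have h := (Literature.NumberTheory.LFunctions.RieszPerron.integrable_Kfun_line (σ := α)
    (m := 1 / 2) (by norm_num) (by rw [abs_of_pos (by linarith)]; exact hα)
    (by rw [abs_of_pos (by linarith)]; linarith) (by rw [abs_of_pos (by linarith)]; linarith)).norm
  exact h

/-- `∫_ℝ ‖K(α + iv)‖ dv ≤ 8π` (`α ≥ 1/2`). [folklore] -/
private theorem integral_norm_rieszK_line_le {α : ℝ} (hα : 1 / 2 ≤ α) :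
    ∫ v : ℝ, ‖rieszK ((α : ℂ) + v * I)‖ ≤ 8 * π := by
  have hg : Integrable fun v : ℝ ↦ 4 * ((1 / 2 : ℝ) ^ 2 + v ^ 2)⁻¹ :=
    (Literature.NumberTheory.LFunctions.RieszPerron.integrable_inv_sq_add_sq
      (m := 1 / 2) (by norm_num)).const_mul 4
  calc ∫ v : ℝ, ‖rieszK ((α : ℂ) + v * I)‖
      ≤ ∫ v : ℝ, 4 * ((1 / 2 : ℝ) ^ 2 + v ^ 2)⁻¹ :=
        integral_mono (integrable_norm_rieszK_line hα) hg (norm_rieszK_line_le hα)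
    _ = 4 * (π / (1 / 2)) := by
        rw [MeasureTheory.integral_const_mul, ZeroDensity.integral_inv_sq_add_sq_real (by norm_num)]
    _ = 8 * π := by ring

/-- **The smoothed kernel under a sup bound for `ζ` on the line `Re s = α`** (the term
`M^{1+α−2σ} M(α, 3T)` of Ivić (11.46): the Halász–Montgomery off-diagonal term with the line of
integration at `α` instead of `1/2`). If `1/2 ≤ α < 1`, `|ζ(α+it)| ≤ S` for `|t| ≤ 3U`, and the
crude bound `|ζ(α+it)| ≤ 1/(1−α) + K(1+|t|)` holds, then for `Y ≥ 1`, `1 ≤ |τ| ≤ U`,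
`‖∑_{n ≤ Y} (1 − n/Y)² n^{−iτ}‖ ≤ 2Y/|τ|³ + Y^α (4S + 2/(1−α) + 6K)`. This is the hypothesis
`hker` of `HalaszTuranLH.halasz_block_count` with `Φ₁ = (4M)^α (4S + 2/(1−α) + 6K)`.
[cite: Ivic1985, §11.4 (11.46)–(11.48)] -/
theorem norm_smoothedKernel_le_line {Y : ℕ} (hY : 1 ≤ Y) {α U S K : ℝ} (hα : 1 / 2 ≤ α)
    (hα1 : α < 1) (hU : 1 ≤ U) (hS0 : 0 ≤ S) (hK0 : 0 ≤ K)
    (hS : ∀ t : ℝ, |t| ≤ 3 * U → ‖riemannZeta ((α : ℂ) + t * I)‖ ≤ S)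
    (hK : ∀ t : ℝ, ‖riemannZeta ((α : ℂ) + t * I)‖ ≤ 1 / (1 - α) + K * (1 + |t|))
    {τ : ℝ} (hτ1 : 1 ≤ |τ|) (hτU : |τ| ≤ U) :
    ‖∑ n ∈ Finset.Icc 1 Y, ((((1 : ℝ) - (n : ℝ) / Y) ^ 2 : ℝ) : ℂ) * (n : ℂ) ^ (-((τ : ℂ) * I))‖ ≤
      2 * Y / |τ| ^ 3 + (Y : ℝ) ^ α * (4 * S + 2 / (1 - α) + 6 * K) := by
  obtain ⟨-, hid⟩ := smoothedKernel_identity_line hY hα hα1 hτ1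
  rw [hid]
  have hY0 : 0 < Y := hY
  have hY0r : (0 : ℝ) < Y := by exact_mod_cast hY0
  have hU0 : 0 < U := by linarith
  have h1α : 0 < 1 - α := by linarith
  have hτ0 : τ ≠ 0 := fun h ↦ by rw [h, abs_zero] at hτ1; linarith
  -- the residue term
  have hres : ‖(Y : ℂ) ^ (1 - (τ : ℂ) * I) * rieszK (1 - (τ : ℂ) * I)‖ ≤ 2 * Y / |τ| ^ 3 := by
    rw [norm_mul]
    have h1 : ‖(Y : ℂ) ^ (1 - (τ : ℂ) * I)‖ = Y := by
      rw [Complex.norm_natCast_cpow_of_pos hY0]; simp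
    have h2 : ‖rieszK (1 - (τ : ℂ) * I)‖ ≤ 2 / |τ| ^ 3 := by
      have h := ZeroDensity.norm_rieszK_le_two_div_cube 1 (y := -τ) (neg_ne_zero.2 hτ0)
      rw [abs_neg] at h
      have e : (((1 : ℝ) : ℂ) + ((-τ : ℝ) : ℂ) * I) = 1 - (τ : ℂ) * I := by push_cast; ring
      rwa [e] at h
    rw [h1]
    calc (Y : ℝ) * ‖rieszK (1 - (τ : ℂ) * I)‖ ≤ Y * (2 / |τ| ^ 3) := by gcongr
      _ = 2 * Y / |τ| ^ 3 := by ring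
  -- the line integral
  set g : ℝ → ℂ := fun v ↦ (Y : ℂ) ^ ((α : ℂ) + v * I) *
    rieszK ((α : ℂ) + v * I) * riemannZeta (α + ((τ : ℂ) + v) * I) with hg
  set fK : ℝ → ℝ := fun v ↦ ‖rieszK ((α : ℂ) + v * I)‖ with hfK
  set f : ℝ → ℝ := fun v ↦ fK v * ‖riemannZeta (α + ((τ : ℂ) + v) * I)‖ with hf
  have hf0 : ∀ v, 0 ≤ f v := fun v ↦ by positivity
  have hnorm_g : ∀ v, ‖g v‖ = (Y : ℝ) ^ α * f v := by
    intro v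
    simp only [hg, hf, hfK, norm_mul]
    rw [Complex.norm_natCast_cpow_of_pos hY0]
    simp
    ring
  have hfKint : Integrable fK := integrable_norm_rieszK_line hα
  have hζarg : ∀ v : ℝ, (α : ℂ) + ((τ : ℂ) + v) * I = (α : ℂ) + ((τ + v : ℝ) : ℂ) * I := by
    intro v; push_cast; ring
  -- `∫ f ≤ 8π S + π (4/(1−α) + 12K)`
  have hfint : ∫ v, f v ≤ 8 * π * S + π * (4 / (1 - α) + 12 * K) := by
    by_cases hfi : Integrable f
    · set s : Set ℝ := Set.Icc (-(2 * U)) (2 * U) with hs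
      have hsm : MeasurableSet s := measurableSet_Icc
      have hsplit : ∫ v, f v = (∫ v in s, f v) + ∫ v in sᶜ, f v := (integral_add_compl hsm hfi).symm
      -- on `s`
      have h_in : ∫ v in s, f v ≤ 8 * π * S := by
        have h1 : ∫ v in s, f v ≤ ∫ v in s, S * fK v := by
          refine setIntegral_mono_on hfi.integrableOn (hfKint.const_mul S).integrableOn hsm ?_
          intro v hv
          simp only [hs, Set.mem_Icc] at hv
          have hτv : |τ + v| ≤ 3 * U := by
            have : |v| ≤ 2 * U := abs_le.2 ⟨hv.1, hv.2⟩
            calc |τ + v| ≤ |τ| + |v| := abs_add_le _ _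
              _ ≤ 3 * U := by linarith
          have hζ := hS (τ + v) hτv
          rw [← hζarg v] at hζ
          simp only [hf]
          rw [mul_comm]
          exact mul_le_mul_of_nonneg_right hζ (norm_nonneg _)
        have h2 : ∫ v in s, S * fK v ≤ ∫ v, S * fK v :=
          setIntegral_le_integral (hfKint.const_mul S) (Eventually.of_forall fun v ↦ by positivity)
        have h3 : ∫ v, S * fK v ≤ S * (8 * π) := by
          rw [MeasureTheory.integral_const_mul]
          exact mul_le_mul_of_nonneg_left (integral_norm_rieszK_line_le hα) hS0
        linarith
      -- on `sᶜ`
      set gm : ℝ → ℝ := fun v ↦ (4 / (1 - α) + 12 * K) * (U ^ 2 + v ^ 2)⁻¹ with hgm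
      have hgmint : Integrable gm :=
        (Literature.NumberTheory.LFunctions.RieszPerron.integrable_inv_sq_add_sq hU0.ne').const_mul _
      have hgm0 : ∀ v, 0 ≤ gm v := fun v ↦ by positivity
      have hfg : ∀ v ∈ sᶜ, f v ≤ gm v := by
        intro v hv
        have hvU : 2 * U < |v| := by
          simp only [hs, Set.mem_compl_iff, Set.mem_Icc, not_and_or, not_le] at hv
          rcases hv with hv | hv
          · rw [abs_of_neg (by linarith)]; linarith
          · rw [abs_of_pos (by linarith)]; exact hv
        have hv0 : v ≠ 0 := fun h ↦ by rw [h, abs_zero] at hvU; linarith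
        have hvp : 0 < |v| := abs_pos.2 hv0
        have hv1 : 1 ≤ |v| := by linarith
        have hKv : fK v ≤ 2 / |v| ^ 3 := ZeroDensity.norm_rieszK_le_two_div_cube α hv0
        have hζ : ‖riemannZeta (α + ((τ : ℂ) + v) * I)‖ ≤ 1 / (1 - α) + 3 * K * |v| := by
          have h := hK (τ + v)
          rw [← hζarg v] at h
          have : |τ + v| ≤ |τ| + |v| := abs_add_le _ _
          have h2 : 1 + |τ + v| ≤ 3 * |v| := by linarith
          calc ‖riemannZeta (α + ((τ : ℂ) + v) * I)‖ ≤ 1 / (1 - α) + K * (1 + |τ + v|) := h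
            _ ≤ 1 / (1 - α) + K * (3 * |v|) := by gcongr
            _ = 1 / (1 - α) + 3 * K * |v| := by ring
        have h1 : f v ≤ 2 / |v| ^ 3 * (1 / (1 - α) + 3 * K * |v|) := by
          simp only [hf]
          exact mul_le_mul hKv hζ (norm_nonneg _) (by positivity)
        refine h1.trans ?_
        simp only [hgm]
        have hu2 : U ^ 2 + v ^ 2 ≤ 2 * |v| ^ 2 := by
          rw [sq_abs]
          have h' : (2 * U) ^ 2 ≤ v ^ 2 := by
            rw [← sq_abs v]; exact pow_le_pow_left₀ (by positivity) hvU.le 2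
          nlinarith
        have hpos : 0 < U ^ 2 + v ^ 2 := by positivity
        have hv3 : 0 < |v| ^ 3 := by positivity
        rw [div_mul_eq_mul_div, div_le_iff₀ hv3,
          show (4 / (1 - α) + 12 * K) * (U ^ 2 + v ^ 2)⁻¹ * |v| ^ 3 =
            ((4 / (1 - α) + 12 * K) * |v| ^ 3) / (U ^ 2 + v ^ 2) by ring,
          le_div_iff₀ hpos]
        have ha : 1 / (1 - α) * (U ^ 2 + v ^ 2) ≤ 2 / (1 - α) * |v| ^ 3 := by
          rw [show 2 / (1 - α) * |v| ^ 3 = 1 / (1 - α) * (2 * |v| ^ 2 * |v|) by ring]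
          refine mul_le_mul_of_nonneg_left ?_ (by positivity)
          calc U ^ 2 + v ^ 2 ≤ 2 * |v| ^ 2 := hu2
            _ = 2 * |v| ^ 2 * 1 := by ring
            _ ≤ 2 * |v| ^ 2 * |v| := by gcongr
        have hb : 3 * K * |v| * (U ^ 2 + v ^ 2) ≤ 6 * K * |v| ^ 3 := by
          calc 3 * K * |v| * (U ^ 2 + v ^ 2) ≤ 3 * K * |v| * (2 * |v| ^ 2) := by gcongr
            _ = 6 * K * |v| ^ 3 := by ring
        calc 2 * (1 / (1 - α) + 3 * K * |v|) * (U ^ 2 + v ^ 2)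
            = 2 * (1 / (1 - α) * (U ^ 2 + v ^ 2) + 3 * K * |v| * (U ^ 2 + v ^ 2)) := by ring
          _ ≤ 2 * (2 / (1 - α) * |v| ^ 3 + 6 * K * |v| ^ 3) := by gcongr
          _ = (4 / (1 - α) + 12 * K) * |v| ^ 3 := by ring
      have h_out : ∫ v in sᶜ, f v ≤ π * (4 / (1 - α) + 12 * K) := by
        calc ∫ v in sᶜ, f v ≤ ∫ v in sᶜ, gm v :=
              setIntegral_mono_on hfi.integrableOn hgmint.integrableOn hsm.compl hfg
          _ ≤ ∫ v, gm v := setIntegral_le_integral hgmint (Eventually.of_forall hgm0)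
          _ = (4 / (1 - α) + 12 * K) * (π / U) := by
              simp only [hgm]
              rw [MeasureTheory.integral_const_mul, ZeroDensity.integral_inv_sq_add_sq_real hU0]
          _ ≤ (4 / (1 - α) + 12 * K) * π := by
              have : π / U ≤ π := div_le_self Real.pi_pos.le hU
              exact mul_le_mul_of_nonneg_left this (by positivity)
          _ = π * (4 / (1 - α) + 12 * K) := by ring
      rw [hsplit]
      linarith
    · rw [integral_undef hfi]; positivity
  have hint_g : ‖∫ v, g v‖ ≤ (Y : ℝ) ^ α * (8 * π * S + π * (4 / (1 - α) + 12 * K)) := by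
    calc ‖∫ v, g v‖ ≤ ∫ v, ‖g v‖ := norm_integral_le_integral_norm _
      _ = ∫ v, (Y : ℝ) ^ α * f v := integral_congr_ae (Eventually.of_forall hnorm_g)
      _ = (Y : ℝ) ^ α * ∫ v, f v := MeasureTheory.integral_const_mul _ _
      _ ≤ (Y : ℝ) ^ α * (8 * π * S + π * (4 / (1 - α) + 12 * K)) :=
          mul_le_mul_of_nonneg_left hfint (Real.rpow_nonneg hY0r.le _)
  have hc : ‖((1 / (2 * π) : ℝ) : ℂ)‖ = 1 / (2 * π) := by
    rw [Complex.norm_real, Real.norm_of_nonneg (by positivity)]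
  calc ‖(Y : ℂ) ^ (1 - (τ : ℂ) * I) * rieszK (1 - (τ : ℂ) * I) +
        ((1 / (2 * π) : ℝ) : ℂ) * ∫ v, g v‖
      ≤ ‖(Y : ℂ) ^ (1 - (τ : ℂ) * I) * rieszK (1 - (τ : ℂ) * I)‖ +
        ‖((1 / (2 * π) : ℝ) : ℂ) * ∫ v, g v‖ := norm_add_le _ _
    _ ≤ 2 * Y / |τ| ^ 3 + 1 / (2 * π) * ((Y : ℝ) ^ α * (8 * π * S + π * (4 / (1 - α) + 12 * K))) := by
        refine add_le_add hres ?_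
        rw [norm_mul, hc]
        exact mul_le_mul_of_nonneg_left hint_g (by positivity)
    _ = 2 * Y / |τ| ^ 3 + (Y : ℝ) ^ α * (4 * S + 2 / (1 - α) + 6 * K) := by
        have hπ : (π : ℝ) ≠ 0 := Real.pi_ne_zero
        field_simp
        ring

end Kernel

end NearOneDetect

end Literature.NumberTheory.LFunctions

end
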